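import Summits.Ventures.PercRepro.C041ZoneZReach

/-!
# THEOREM Z′ (the ZONE LEMMA with forced edges, C-041.md §13) — the model and its involutions (p6, gen 27)

Setting of `C041ZoneZReach`.  A zone WITH FORCED EDGES (`FZone`, extending `ZoneData`): every edge is FREE or carries
a forced colour `fcol`; the forced-blue edges lie inside an UNMARKED BLUE-ISOLATED region `iso` — every edge touching
`iso` is forced and no terminal edge sits at a vertex of `iso` (the 𝒲(O)-family of a skeleton: forced-red = the red
`O`-edges, free = the interior blue edges `B(O)`, forced-blue = the blue `O`-edges of the zones without terminal
edges, `iso` = those zones).  A state RESPECTS the forced colours when `Forced σ`.  Red / blue adjacency are those of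
`ZoneData` (the colour of the state, whatever the kind of the edge); `FreeRedAdj` / `FreeBlueAdj` use free edges only;
the MIXED adjacency `MixedAdjF P` (a free blue edge not touching `P`, or a red edge that is forced or touches `P`) is
the red adjacency of the state before a complement outside `P`.  The involutions `flipOutF` / `dualF` complement the
FREE edges not touching `X` (and swap the `1`-patterns outside `X`); they preserve `Forced` and are involutions.
The zone sets of §13 (`LsetF`, `RsetF`, `KsetF`, `PsetF`, `WsetF`, `K2setF`, `P2setF`) are those of §12 with `Forced`
added and the first `K2` condition read on the free red adjacency.
-/

namespace PercRepro

namespace ZoneZ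

open Finset

/-- An abstract zone with forced edges: a `ZoneData` with a class of FREE edges, a forced colour for the other
edges, and an unmarked blue-isolated region `iso` containing every forced-blue edge. -/
structure FZone (V E T₁ T₂ : Type*) extends ZoneData V E T₁ T₂ where
  /-- the free edges -/
  free : E → Prop
  /-- the forced colour of a non-free edge (`true` = red) -/
  fcol : E → Bool
  /-- the blue-isolated region -/
  iso : Set V
  /-- a forced-blue edge has both ends in `iso` -/
  fblue_mem : ∀ e, ¬ free e → fcol e = false → fst e ∈ iso ∧ snd e ∈ iso
  /-- every edge touching `iso` is forced -/
  iso_forced : ∀ e, (fst e ∈ iso ∨ snd e ∈ iso) → ¬ free e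
  /-- no `1`-edge at a vertex of `iso` -/
  iso_unmarked₁ : ∀ t, at₁ t ∉ iso
  /-- no `2`-edge at a vertex of `iso` -/
  iso_unmarked₂ : ∀ t, at₂ t ∉ iso

namespace FZone

variable {V E T₁ T₂ : Type*} (F : FZone V E T₁ T₂)

/-! ## Forced states and the free / mixed adjacencies -/

/-- The state respects the forced colours. -/
def Forced (σ : State E T₁ T₂) : Prop := ∀ e, ¬ F.free e → σ.1 e = F.fcol e

/-- Red adjacency through a free edge. -/
def FreeRedAdj (σ : State E T₁ T₂) : V → V → Prop := F.Adj (fun e b => F.free e ∧ b = true) σ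

/-- Blue adjacency through a free edge. -/
def FreeBlueAdj (σ : State E T₁ T₂) : V → V → Prop := F.Adj (fun e b => F.free e ∧ b = false) σ

/-- The MIXED adjacency relative to `P`: a free blue edge not touching `P`, or a red edge that is forced or touches
`P` — the red adjacency of the state before the free edges outside `P` were complemented. -/
def MixedAdjF (P : Set V) (σ : State E T₁ T₂) : V → V → Prop :=
  F.Adj (fun e b => (F.free e ∧ ¬ F.Touches P e ∧ b = false) ∨ ((¬ F.free e ∨ F.Touches P e) ∧ b = true)) σ

/-- `C`: the mixed reach of the anchors relative to `P`. -/
def CmixF (Q A : Set V) (σ : State E T₁ T₂) : Set V := ZoneData.reach (F.MixedAdjF (F.P Q σ) σ) A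

/-! ## The involutions on the free edges -/

open Classical in
/-- Complement the colours of the free edges not touching `X`. -/
noncomputable def flipColF (X : Set V) (c : E → Bool) : E → Bool := fun e =>
  if F.Touches X e ∨ ¬ F.free e then c e else !c e

/-- An edge touching `X` keeps its colour. -/
theorem flipColF_of_touches (X : Set V) (c : E → Bool) {e : E} (h : F.Touches X e) : F.flipColF X c e = c e := by
  unfold flipColF
  rw [if_pos (Or.inl h)]

/-- A forced edge keeps its colour. -/
theorem flipColF_of_not_free (X : Set V) (c : E → Bool) {e : E} (h : ¬ F.free e) : F.flipColF X c e = c e := by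
  unfold flipColF
  rw [if_pos (Or.inr h)]

/-- A free edge not touching `X` is complemented. -/
theorem flipColF_of_free (X : Set V) (c : E → Bool) {e : E} (hf : F.free e) (h : ¬ F.Touches X e) :
    F.flipColF X c e = !c e := by
  unfold flipColF
  rw [if_neg]
  rintro (h' | h')
  · exact h h'
  · exact h' hf

/-- The complement is an involution. -/
theorem flipColF_flipColF (X : Set V) (c : E → Bool) : F.flipColF X (F.flipColF X c) = c := by
  funext e
  by_cases hf : F.free e
  · by_cases h : F.Touches X e
    · rw [F.flipColF_of_touches X _ h, F.flipColF_of_touches X c h]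
    · rw [F.flipColF_of_free X _ hf h, F.flipColF_of_free X c hf h, Bool.not_not]
  · rw [F.flipColF_of_not_free X _ hf, F.flipColF_of_not_free X c hf]

/-- The state with the free edges not touching `X` complemented. -/
noncomputable def flipOutF (X : Set V) (σ : State E T₁ T₂) : State E T₁ T₂ := (F.flipColF X σ.1, σ.2.1, σ.2.2)

/-- The state with the free edges not touching `X` complemented and the `1`-patterns outside `X` swapped. -/
noncomputable def dualF (X : Set V) (σ : State E T₁ T₂) : State E T₁ T₂ :=
  (F.flipColF X σ.1, swapMark F.at₁ X σ.2.1, σ.2.2)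

/-- `flipOutF X` is an involution. -/
theorem flipOutF_flipOutF (X : Set V) (σ : State E T₁ T₂) : F.flipOutF X (F.flipOutF X σ) = σ := by
  obtain ⟨c, m₁, m₂⟩ := σ
  simp only [flipOutF, F.flipColF_flipColF]

/-- `dualF X` is an involution. -/
theorem dualF_dualF (X : Set V) (σ : State E T₁ T₂) : F.dualF X (F.dualF X σ) = σ := by
  obtain ⟨c, m₁, m₂⟩ := σ
  simp only [dualF, F.flipColF_flipColF, swapMark_swapMark]

/-- `flipOutF X` is injective. -/
theorem flipOutF_injective (X : Set V) : Function.Injective (F.flipOutF X) :=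
  ZoneData.injective_of_involutive _ (F.flipOutF_flipOutF X)

/-- `dualF X` is injective. -/
theorem dualF_injective (X : Set V) : Function.Injective (F.dualF X) :=
  ZoneData.injective_of_involutive _ (F.dualF_dualF X)

/-! ## Colours, marks and forcedness of the images -/

/-- The dual keeps the colour of an edge touching `X`. -/
theorem dualF_fst_of_touches (X : Set V) (σ : State E T₁ T₂) {e : E} (h : F.Touches X e) :
    (F.dualF X σ).1 e = σ.1 e :=
  F.flipColF_of_touches X σ.1 h

/-- The dual keeps the colour of a forced edge. -/
theorem dualF_fst_of_not_free (X : Set V) (σ : State E T₁ T₂) {e : E} (h : ¬ F.free e) :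
    (F.dualF X σ).1 e = σ.1 e :=
  F.flipColF_of_not_free X σ.1 h

/-- The dual complements a free edge not touching `X`. -/
theorem dualF_fst_of_free (X : Set V) (σ : State E T₁ T₂) {e : E} (hf : F.free e) (h : ¬ F.Touches X e) :
    (F.dualF X σ).1 e = !σ.1 e :=
  F.flipColF_of_free X σ.1 hf h

/-- The complement keeps the colour of an edge touching `X`. -/
theorem flipOutF_fst_of_touches (X : Set V) (σ : State E T₁ T₂) {e : E} (h : F.Touches X e) :
    (F.flipOutF X σ).1 e = σ.1 e :=
  F.flipColF_of_touches X σ.1 h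

/-- The complement keeps the colour of a forced edge. -/
theorem flipOutF_fst_of_not_free (X : Set V) (σ : State E T₁ T₂) {e : E} (h : ¬ F.free e) :
    (F.flipOutF X σ).1 e = σ.1 e :=
  F.flipColF_of_not_free X σ.1 h

/-- The complement complements a free edge not touching `X`. -/
theorem flipOutF_fst_of_free (X : Set V) (σ : State E T₁ T₂) {e : E} (hf : F.free e) (h : ¬ F.Touches X e) :
    (F.flipOutF X σ).1 e = !σ.1 e :=
  F.flipColF_of_free X σ.1 hf h

/-- The complement does not change the marks. -/
theorem Bl_flipOutF (X : Set V) (σ : State E T₁ T₂) : F.Bl (F.flipOutF X σ) = F.Bl σ := rfl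
/-- The complement does not change the marks. -/
theorem Blt_flipOutF (X : Set V) (σ : State E T₁ T₂) : F.Blt (F.flipOutF X σ) = F.Blt σ := rfl
/-- The complement does not change the marks. -/
theorem M_flipOutF (X : Set V) (σ : State E T₁ T₂) : F.M (F.flipOutF X σ) = F.M σ := rfl
/-- The complement does not change the marks. -/
theorem Mt_flipOutF (X : Set V) (σ : State E T₁ T₂) : F.Mt (F.flipOutF X σ) = F.Mt σ := rfl
/-- The dual does not change the `2`-marks. -/
theorem M_dualF (X : Set V) (σ : State E T₁ T₂) : F.M (F.dualF X σ) = F.M σ := rfl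
/-- The dual does not change the `2`-marks. -/
theorem Mt_dualF (X : Set V) (σ : State E T₁ T₂) : F.Mt (F.dualF X σ) = F.Mt σ := rfl

/-- Inside `X` the dual keeps the blue `1`-marks. -/
theorem mem_Bl_dualF_of_mem (X : Set V) (σ : State E T₁ T₂) {v : V} (hv : v ∈ X) :
    v ∈ F.Bl (F.dualF X σ) ↔ v ∈ F.Bl σ :=
  mem_markSet_swapMark_of_mem F.at₁ X σ.2.1 false hv

/-- Inside `X` the dual keeps the red `1`-marks. -/
theorem mem_Blt_dualF_of_mem (X : Set V) (σ : State E T₁ T₂) {v : V} (hv : v ∈ X) :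
    v ∈ F.Blt (F.dualF X σ) ↔ v ∈ F.Blt σ :=
  mem_markSet_swapMark_of_mem F.at₁ X σ.2.1 true hv

/-- Outside `X` the blue `1`-marks of the dual are the red `1`-marks of the state. -/
theorem mem_Bl_dualF_of_not_mem (X : Set V) (σ : State E T₁ T₂) {v : V} (hv : v ∉ X) :
    v ∈ F.Bl (F.dualF X σ) ↔ v ∈ F.Blt σ :=
  mem_markSet_swapMark_of_not_mem F.at₁ X σ.2.1 false hv

/-- Outside `X` the red `1`-marks of the dual are the blue `1`-marks of the state. -/
theorem mem_Blt_dualF_of_not_mem (X : Set V) (σ : State E T₁ T₂) {v : V} (hv : v ∉ X) :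
    v ∈ F.Blt (F.dualF X σ) ↔ v ∈ F.Bl σ :=
  mem_markSet_swapMark_of_not_mem F.at₁ X σ.2.1 true hv

/-- The dual preserves the forced colours. -/
theorem forced_dualF (X : Set V) {σ : State E T₁ T₂} (h : F.Forced σ) : F.Forced (F.dualF X σ) := by
  intro e he
  rw [F.dualF_fst_of_not_free X σ he]
  exact h e he

/-- The complement preserves the forced colours. -/
theorem forced_flipOutF (X : Set V) {σ : State E T₁ T₂} (h : F.Forced σ) : F.Forced (F.flipOutF X σ) := by
  intro e he
  rw [F.flipOutF_fst_of_not_free X σ he]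
  exact h e he

/-! ## The zone sets of §13 -/

section Sets

variable [Fintype E] [DecidableEq E] [Fintype T₁] [DecidableEq T₁] [Fintype T₂] [DecidableEq T₂] (Q A : Set V)

open Classical in
/-- `𝓛_Z`: forced, admissible, blue at `K`, some anchor deleted (with `Γ`). -/
noncomputable def LsetF : Finset (State E T₁ T₂) :=
  univ.filter fun σ => F.Forced σ ∧ F.adm σ ∧ F.blueK A σ ∧ F.anchorDel A σ ∧ F.Gam Q σ

open Classical in
/-- `𝓡_Z`: forced, admissible, no anchor deleted, no red `2`-edge at `REACH`, a red terminal edge at `K` (with `Γ`). -/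
noncomputable def RsetF : Finset (State E T₁ T₂) :=
  univ.filter fun σ => F.Forced σ ∧ F.adm σ ∧ ¬ F.anchorDel A σ ∧ F.reach2 A σ ∧ ¬ F.blueK A σ ∧ F.Gam Q σ

open Classical in
/-- `Κ`: forced, admissible, blue at `K` (with `Γ`). -/
noncomputable def KsetF : Finset (State E T₁ T₂) :=
  univ.filter fun σ => F.Forced σ ∧ F.adm σ ∧ F.blueK A σ ∧ F.Gam Q σ

open Classical in
/-- `Ρ′`: forced, admissible, no anchor deleted, no red `2`-edge at `REACH` (with `Γ`). -/
noncomputable def PsetF : Finset (State E T₁ T₂) :=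
  univ.filter fun σ => F.Forced σ ∧ F.adm σ ∧ ¬ F.anchorDel A σ ∧ F.reach2 A σ ∧ F.Gam Q σ

open Classical in
/-- `W`: the common remainder — forced, admissible, no anchor deleted, blue at `K` (with `Γ`). -/
noncomputable def WsetF : Finset (State E T₁ T₂) :=
  univ.filter fun σ => F.Forced σ ∧ F.adm σ ∧ ¬ F.anchorDel A σ ∧ F.blueK A σ ∧ F.Gam Q σ

open Classical in
/-- `K2`: the image of `Κ` under the first dual (STEP 2), the first condition on the free red adjacency. -/
noncomputable def K2setF : Finset (State E T₁ T₂) :=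
  univ.filter fun σ => F.Forced σ ∧ Disjoint (F.M σ) (ZoneData.reachIn (F.FreeRedAdj σ) (F.P Q σ)ᶜ (F.Blt σ)) ∧
    Disjoint (F.CmixF Q A σ) (F.Bl σ ∪ F.Mt σ ∪ (F.Blt σ ∩ F.P Q σ)) ∧ F.Gam Q σ

open Classical in
/-- `P2`: the set between the comparison (STEP 3) and `Ρ′` (STEP 1). -/
noncomputable def P2setF : Finset (State E T₁ T₂) :=
  univ.filter fun σ => F.Forced σ ∧ F.adm σ ∧ Disjoint (F.CmixF Q A σ) (F.Bl σ ∪ F.Mt σ) ∧ F.Gam Q σ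

end Sets

end FZone

end ZoneZ

end PercRepro
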